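import Literature.MathematicalPhysics.QuantumFieldTheory.Balaban1983to89.Node00.N24GlueStage5
import Literature.MathematicalPhysics.QuantumFieldTheory.Balaban1983to89.B16NodeKnitRecord5

/-!
# NODE N24 · binder B2 at the Stage-5 record WITH THE CHILDREN N11 AND N13 ENTERED BY NAME AT THEIR CURRENT STATEMENTS OF RECORD
# (`B14NodeKnitRecord5.b14_main_of_isRecordOfRecord₅`, seat dag-n11-a; `B16NodeKnitRecord5.b16_main_reExp_of_isRecordOfRecord₅`, seat dag-n13-a)

TRACK A (YM-PLAN §2d, node N24 of 28), seat `pub-ymgap-dag-n24-a` (-a KNIT-BY-NAME: «keep the glue elaborating against the children's CURRENT statements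
of record … report which child blocks»).  SIXTH N24 module, a NEW importing one (append-only growth).  The two children that HAVE a knit at NODE 00's
Stage-5 record today are composed INTO the glue of `Node00.N24GlueStage5` (p411641) in the kernel — an integration check by name: N11 = [Balaban1988Convergent]
Thm 1 via `B14NodeKnitRecord5.b14_main_of_isRecordOfRecord₅ h slots₁₁` (two located pins (P1₅) (P3₅) + two displayed printed slots (S0) (S1), stated over the
record's residual fields), N13 = [Balaban1989LargeFieldII] Thm 1 ∧ [III] Cor. 3 in the DESIGN-E reading via
`B16NodeKnitRecord5.b16_main_reExp_of_isRecordOfRecord₅ e₋ e₊ h hR hcor` (datum-indexed exponent families `e₋ e₊ : FiniteEpsData → ℝ → ℝ`; (R₅) = [III] p. 244's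
property of the residual 𝐑-carrier; `hcor` = a representation family of `(datumOfRecord₅ θ).C` with [III] p. 264's five leaves at `(w.γ, e₋ D, e₊ D)`), fed
into `N24_at_record₅_of_N13_exists`.  THEOREMS ONLY, def-free, sorry-free, standard axioms.

* `N24_at_record₅_knit₁₁₁₃` — (B2) `B16.EndStatementBPrinted D.C` at a Stage-5 record from: N03, N05–N10, N12 as by-name binders at the record world; N11's
  slots; N13's exponent families + slots; the β-box bounds on `D.βfun`.  `N24_at_record₅_knit₁₁₁₃_of_prop26`: N03 at its statement of record too.
* `N24_binders₅_after_knit` — the REMAINING binder list displayed as one `Prop`-valued implication, for the hourly «which child blocks».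

WHICH CHILD BLOCKS after this knit (2026-08-26T00:0xZ): THEOREMS — N01 N02 N04 N23, `hC` `hγ` (0.20) (Record5); BY NAME MODULO DISPLAYED SLOTS — N03 (Prop.
2.6 census), N11 (P1₅ P3₅ S0 S1 over `Residual₅.V ∕ R ∕ S218`, n11-a), N13 ((R₅) + the five Cor.-3 leaves at `(w.γ, e₋ D, e₊ D)`, n13-a; the leaves' one-run
derivation is `B16Cor3CurlyGas`, n14-b ∕ n21-b); PURE BINDERS — N05 [B8], N06 [B9] (undetermined over ₅: free residual `Y`, `B9LeafUnpinnedRecord5`), N07 [B11],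
N08 [B10] (literal at ₅ ∕ compact at ₅C), N09 [B12], N10 [B13], N12 [B15]; the β-box bounds (`b > 0` UNPRINTED T09.F; β⁺ [Balaban1987RG1] p. 264).  At ₅C the
same knit waits for the ₅C twins of the two children's theorems (their `hup` reads the N-binding; `b10` is an unused antecedent of both nodes).
HONEST FRAMING: kernel bookkeeping BY NAME; every slot is a HYPOTHESIS displayed by the child's seat, nothing of Bałaban's asserted; N24 COMPOSITE — no
discharge, no count; cruxes junk-inhabited over ₅ by design until stage ₈; finite T⁴ at fixed ε; NOT ℝ⁴ ∕ OS ∕ mass gap ∕ Clay.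
-/

noncomputable section

namespace Literature.MathematicalPhysics.QuantumFieldTheory.Balaban1983to89.Node00

open DagBinding T4Continuum T4DatumAssembly FlowStepRuns AveragingRT

variable {F : T4Family} {N : ℕ} [NeZero N] {D : FiniteEpsData F (SU N)} {w : WorldP}

/-- **N24 · (B2) at a Stage-5 record with N11 and N13 KNIT BY NAME.**  Inputs: the record `h`; `w.γ ≤ γ₀`; N03, N05–N10, N12 at every run of `w` (binders);
N11's slots VERBATIM as `B14NodeKnitRecord5.b14_main_of_isRecordOfRecord₅` displays them (space families `S`, `Scorr` per run with (P1₅) «the 𝐑-leaf of record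
speaks about the record's own `R`», (P3₅) «the index space implies the (2.18) format», (S0) the Wilson start in the index-0 space, (S1) the Theorem of p. 245
along the tower); N13's datum-indexed exponent families `e₋ e₊` with (R₅) and the five Cor.-3 leaves at `(w.γ, e₋ D, e₊ D)` VERBATIM as
`B16NodeKnitRecord5.b16_main_reExp_of_isRecordOfRecord₅` displays them; the box bounds `w.b ≤ D.βfun ≤ w.βup` on `]0, γ₀]^{k+1}`.  Output:
`B16.EndStatementBPrinted D.C`, by `N24_at_record₅_of_N13_exists` with `h11 := b14_main_of_isRecordOfRecord₅ h slots₁₁` and the N13 witness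
`(e₋ D, e₊ D, b16_main_reExp_of_isRecordOfRecord₅ e₋ e₊ h hR hcor)`. [cite: Balaban1989LargeFieldII, Thm 1 p.355 + pp.387, 391; Balaban1988Convergent, Thm 1 p.262, Theorem p.245, p.244, Cor. 3 (2.50) p.264; Balaban1987RG1, (1.22) p.264 (bookkeeping over the pinned form)] -/
theorem N24_at_record₅_knit₁₁₁₃ (h : IsRecordOfRecord₅ F N D w) {γ₀ : ℝ} (hγ₀ : w.γ ≤ γ₀)
    (h03 : ∀ P : B12.RunParams, Dag.B6_main (leavesP w P)) (h05 : ∀ P : B12.RunParams, Dag.B8_main (leavesP w P))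
    (h06 : ∀ P : B12.RunParams, Dag.B9_main (leavesP w P)) (h07 : ∀ P : B12.RunParams, Dag.B11_main (leavesP w P))
    (h08 : ∀ P : B12.RunParams, Dag.B10_main (leavesP w P)) (h09 : ∀ P : B12.RunParams, Dag.B12_main (leavesP w P))
    (h10 : ∀ P : B12.RunParams, Dag.B13_main (leavesP w P)) (h12 : ∀ P : B12.RunParams, Dag.B15_main (leavesP w P))
    (slots₁₁ : ∀ θ : Stage5Params F N, θ.Admissible → D = datumOfRecord₅ F N θ →
      (∀ P, w.up P = upOfRecord₅ F N θ P) → ∀ P : B12.RunParams,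
        ∃ S Scorr : (k : ℕ) → Density (F.P P.K) k (SU N) → Prop,
          (ROpLeaf (θ.res.V P) → B14.RAssumedP244 (θ.res.R P) Scorr S P.K) ∧
          (∀ k, k ≤ P.K → S k (densOfRecord₅ F N θ P k) → θ.res.S218 P k (densOfRecord₅ F N θ P k)) ∧
          ((leavesP w P).smallCouplings → S 0 (rhoZeroOfRecord F N P.K P.g0 (θ.res.E P))) ∧
          ((leavesP w P).b7 → (leavesP w P).b8 → (leavesP w P).b9 → (leavesP w P).b10 → (leavesP w P).b11 →
            (leavesP w P).smallCouplings → (leavesP w P).smallFieldInductive → (leavesP w P).flowControl →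
              ∀ k, k < P.K → S k (densOfRecord₅ F N θ P k) →
                Scorr (k + 1) (TrhoOfRecord F N P.K k (densOfRecord₅ F N θ P k))))
    (eM eP : FiniteEpsData F (SU N) → ℝ → ℝ)
    (hR : ∀ θ : Stage5Params F N, θ.Admissible → D = datumOfRecord₅ F N θ → ∀ P : B12.RunParams, ROpLeaf (θ.res.V P))
    (hcor : ∀ θ : Stage5Params F N, θ.Admissible → D = datumOfRecord₅ F N θ →
      ∃ R : B14Cor3.ReprFamily (datumOfRecord₅ F N θ).C,
        B14Cor3.LeafH (datumOfRecord₅ F N θ).C R w.γ ∧ B14Cor3.LeafU1 (datumOfRecord₅ F N θ).C R w.γ ∧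
        B14Cor3.LeafU2 (datumOfRecord₅ F N θ).C R w.γ (eP D) ∧ B14Cor3.LeafL1 (datumOfRecord₅ F N θ).C R w.γ ∧
        B14Cor3.LeafL2 (datumOfRecord₅ F N θ).C R w.γ (eM D))
    (hlo : FlowStep.BetaLowerH w.b γ₀ D.βfun) (hhi : FlowStep.BetaUpperH w.βup γ₀ D.βfun) :
    B16.EndStatementBPrinted D.C :=
  N24_at_record₅_of_N13_exists h hγ₀ h03 h05 h06 h07 h08 h09 h10
    (B14NodeKnitRecord5.b14_main_of_isRecordOfRecord₅ h slots₁₁) h12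
    ⟨eM D, eP D, B16NodeKnitRecord5.b16_main_reExp_of_isRecordOfRecord₅ eM eP h hR hcor⟩ hlo hhi

/-- **The same knit with N03 entered at ITS statement of record** (modulo the [Balaban1984PropagatorsII] Prop. 2.6 census,
`Record5.b6_main_of_isRecordOfRecord₅_of_prop26`): seven pure binders N05–N10, N12 remain beside the displayed slots of N03 ∕ N11 ∕ N13 and the β-box
bounds. [cite: Balaban1989LargeFieldII, Thm 1 p.355 + p.391; Balaban1984PropagatorsII, Prop. 2.6 (2.136)–(2.140) p.247; Balaban1988Convergent, Thm 1 p.262, Cor. 3 (2.50) p.264 (bookkeeping)] -/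
theorem N24_at_record₅_knit₁₁₁₃_of_prop26 (h : IsRecordOfRecord₅ F N D w) {γ₀ : ℝ} (hγ₀ : w.γ ≤ γ₀)
    (h26 : ∀ θ : Stage3Params, θ.toStage1Params.Admissible →
      B6.Prop26Printed (fun i : B6KLevelCensusIndexV1.KIdx θ.d₆ θ.ℓ₆ θ.hd' θ.hL' θ.b₀ θ.b₁ => B6KLevelCensusIndexV1.kGeoG i)
        (fun i => B6Prop26Census2136KLevelV1.kG i))
    (h05 : ∀ P : B12.RunParams, Dag.B8_main (leavesP w P))
    (h06 : ∀ P : B12.RunParams, Dag.B9_main (leavesP w P)) (h07 : ∀ P : B12.RunParams, Dag.B11_main (leavesP w P))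
    (h08 : ∀ P : B12.RunParams, Dag.B10_main (leavesP w P)) (h09 : ∀ P : B12.RunParams, Dag.B12_main (leavesP w P))
    (h10 : ∀ P : B12.RunParams, Dag.B13_main (leavesP w P)) (h12 : ∀ P : B12.RunParams, Dag.B15_main (leavesP w P))
    (slots₁₁ : ∀ θ : Stage5Params F N, θ.Admissible → D = datumOfRecord₅ F N θ →
      (∀ P, w.up P = upOfRecord₅ F N θ P) → ∀ P : B12.RunParams,
        ∃ S Scorr : (k : ℕ) → Density (F.P P.K) k (SU N) → Prop,
          (ROpLeaf (θ.res.V P) → B14.RAssumedP244 (θ.res.R P) Scorr S P.K) ∧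
          (∀ k, k ≤ P.K → S k (densOfRecord₅ F N θ P k) → θ.res.S218 P k (densOfRecord₅ F N θ P k)) ∧
          ((leavesP w P).smallCouplings → S 0 (rhoZeroOfRecord F N P.K P.g0 (θ.res.E P))) ∧
          ((leavesP w P).b7 → (leavesP w P).b8 → (leavesP w P).b9 → (leavesP w P).b10 → (leavesP w P).b11 →
            (leavesP w P).smallCouplings → (leavesP w P).smallFieldInductive → (leavesP w P).flowControl →
              ∀ k, k < P.K → S k (densOfRecord₅ F N θ P k) →
                Scorr (k + 1) (TrhoOfRecord F N P.K k (densOfRecord₅ F N θ P k))))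
    (eM eP : FiniteEpsData F (SU N) → ℝ → ℝ)
    (hR : ∀ θ : Stage5Params F N, θ.Admissible → D = datumOfRecord₅ F N θ → ∀ P : B12.RunParams, ROpLeaf (θ.res.V P))
    (hcor : ∀ θ : Stage5Params F N, θ.Admissible → D = datumOfRecord₅ F N θ →
      ∃ R : B14Cor3.ReprFamily (datumOfRecord₅ F N θ).C,
        B14Cor3.LeafH (datumOfRecord₅ F N θ).C R w.γ ∧ B14Cor3.LeafU1 (datumOfRecord₅ F N θ).C R w.γ ∧
        B14Cor3.LeafU2 (datumOfRecord₅ F N θ).C R w.γ (eP D) ∧ B14Cor3.LeafL1 (datumOfRecord₅ F N θ).C R w.γ ∧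
        B14Cor3.LeafL2 (datumOfRecord₅ F N θ).C R w.γ (eM D))
    (hlo : FlowStep.BetaLowerH w.b γ₀ D.βfun) (hhi : FlowStep.BetaUpperH w.βup γ₀ D.βfun) :
    B16.EndStatementBPrinted D.C :=
  N24_at_record₅_knit₁₁₁₃ h hγ₀ (b6_main_of_isRecordOfRecord₅_of_prop26 h26 h) h05 h06 h07 h08 h09 h10 h12 slots₁₁ eM eP hR hcor
    hlo hhi

/-- **WHICH CHILD BLOCKS, in kernel form**: after the knit the (B2) binder at a Stage-5 record is implied by the SEVEN pure child binders N05 [B8], N06 [B9],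
N07 [B11], N08 [B10], N09 [B12], N10 [B13], N12 [B15] at the record world together with N03's census, N11's slots, N13's exponent families + slots and the
β-box bounds — one implication, every antecedent displayed (nothing asserted). [cite: Balaban1989LargeFieldII, Thm 1 p.355 + p.391 (bookkeeping: the residual binder list of N24 at Stage 5)] -/
theorem N24_binders₅_after_knit (h : IsRecordOfRecord₅ F N D w) {γ₀ : ℝ} (hγ₀ : w.γ ≤ γ₀)
    (h26 : ∀ θ : Stage3Params, θ.toStage1Params.Admissible →
      B6.Prop26Printed (fun i : B6KLevelCensusIndexV1.KIdx θ.d₆ θ.ℓ₆ θ.hd' θ.hL' θ.b₀ θ.b₁ => B6KLevelCensusIndexV1.kGeoG i)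
        (fun i => B6Prop26Census2136KLevelV1.kG i))
    (slots₁₁ : ∀ θ : Stage5Params F N, θ.Admissible → D = datumOfRecord₅ F N θ →
      (∀ P, w.up P = upOfRecord₅ F N θ P) → ∀ P : B12.RunParams,
        ∃ S Scorr : (k : ℕ) → Density (F.P P.K) k (SU N) → Prop,
          (ROpLeaf (θ.res.V P) → B14.RAssumedP244 (θ.res.R P) Scorr S P.K) ∧
          (∀ k, k ≤ P.K → S k (densOfRecord₅ F N θ P k) → θ.res.S218 P k (densOfRecord₅ F N θ P k)) ∧
          ((leavesP w P).smallCouplings → S 0 (rhoZeroOfRecord F N P.K P.g0 (θ.res.E P))) ∧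
          ((leavesP w P).b7 → (leavesP w P).b8 → (leavesP w P).b9 → (leavesP w P).b10 → (leavesP w P).b11 →
            (leavesP w P).smallCouplings → (leavesP w P).smallFieldInductive → (leavesP w P).flowControl →
              ∀ k, k < P.K → S k (densOfRecord₅ F N θ P k) →
                Scorr (k + 1) (TrhoOfRecord F N P.K k (densOfRecord₅ F N θ P k))))
    (eM eP : FiniteEpsData F (SU N) → ℝ → ℝ)
    (hR : ∀ θ : Stage5Params F N, θ.Admissible → D = datumOfRecord₅ F N θ → ∀ P : B12.RunParams, ROpLeaf (θ.res.V P))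
    (hcor : ∀ θ : Stage5Params F N, θ.Admissible → D = datumOfRecord₅ F N θ →
      ∃ R : B14Cor3.ReprFamily (datumOfRecord₅ F N θ).C,
        B14Cor3.LeafH (datumOfRecord₅ F N θ).C R w.γ ∧ B14Cor3.LeafU1 (datumOfRecord₅ F N θ).C R w.γ ∧
        B14Cor3.LeafU2 (datumOfRecord₅ F N θ).C R w.γ (eP D) ∧ B14Cor3.LeafL1 (datumOfRecord₅ F N θ).C R w.γ ∧
        B14Cor3.LeafL2 (datumOfRecord₅ F N θ).C R w.γ (eM D))
    (hlo : FlowStep.BetaLowerH w.b γ₀ D.βfun) (hhi : FlowStep.BetaUpperH w.βup γ₀ D.βfun) :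
    ((∀ P : B12.RunParams, Dag.B8_main (leavesP w P)) → (∀ P : B12.RunParams, Dag.B9_main (leavesP w P)) →
      (∀ P : B12.RunParams, Dag.B11_main (leavesP w P)) → (∀ P : B12.RunParams, Dag.B10_main (leavesP w P)) →
      (∀ P : B12.RunParams, Dag.B12_main (leavesP w P)) → (∀ P : B12.RunParams, Dag.B13_main (leavesP w P)) →
      (∀ P : B12.RunParams, Dag.B15_main (leavesP w P)) → B16.EndStatementBPrinted D.C) :=
  fun h05 h06 h07 h08 h09 h10 h12 =>
    N24_at_record₅_knit₁₁₁₃_of_prop26 h hγ₀ h26 h05 h06 h07 h08 h09 h10 h12 slots₁₁ eM eP hR hcor hlo hhi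

end Literature.MathematicalPhysics.QuantumFieldTheory.Balaban1983to89.Node00

end
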